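import Mathlib
import HarnessLib
import HarnessLib.Audit
import Summits.QuantumFields.Statement
import Literature.MathematicalPhysics.QuantumFieldTheory.Balaban1983to89.T3YM3TorusStatement
import Literature.MathematicalPhysics.QuantumFieldTheory.Balaban1983to89.T3ContinuumYM3TorusNonempty
import Literature.MathematicalPhysics.QuantumFieldTheory.Balaban1983to89.T3CovarianceRP
import Literature.MathematicalPhysics.QuantumFieldTheory.Balaban1983to89.T3CentreSymmetry
import Literature.MathematicalPhysics.QuantumFieldTheory.LatticeLangevinDynamics
import HarnessLib.Audit.Status.Attr

/-!
Route: ColdStartUniversality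

# Route ColdStartUniversality — cut-off-uniform cold-start mixing of the SU(2) lattice Langevin
dynamics in physical time, asked on the CENTRE-NEUTRAL sector only, makes Bałaban's 3-D torus
expectations Cauchy (rung R3 YM3TorusSU2, RECORD, not Clay)

LINE (D-0145 ideator seat ym-idea-5; g3 birth, rev 3 = g7 LINE 6 «centre-sector reduction»;
technique «probabilistic model → deterministic statement»;
bears_on LADDER-YM rung R3 = leaf `T3YM3TorusStatement.YM3TorusSU2` (RECORD†: existence AND
uniqueness of Bałaban's ultraviolet limit of pure SU(2)
Yang–Mills on the 3-torus); NO summit, rung or Clay statement is proved by this line or its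
revision; the YM mass gap is NOT proved).
It suffices to show X = K_A1|Γ ∧ K_A2 (given the support S): run the Shen–Zhu–Zhu lattice Langevin
dynamics `latticeLangevinDynamics` (SZZ coupling
β' = β_K/2, β_K = (γ ε_K)⁻¹) on Bałaban's K-th approximation lattice from the COLD START (all links
1) for a PHYSICAL time T (lattice time T/ε_K);
K_A1|Γ `NeutralColdStartMixing` (rev 3): for every loop string whose winding numbers add up to an
EVEN number in each of the three directions of the
torus (the sector invariant under 't Hooft's Z₂³ electric centre twists), the physical-time Cesàro
mean of the block-averaged loop-string observable is
δ-close to Bałaban's step-K Gibbs expectation `expectAt K os` for one T and ALL large K; K_A2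
`ColdStartContinuumCauchy`: at fixed physical T those
Cesàro means are Cauchy in K; S `ColdStartSolutionsExist` (proved, p618112). The CHARGED sector (odd
total winding in some direction — every string
containing an odd number of Polyakov lines) is decided EXACTLY and statically inside `closes`: by
the tree theorem
`T3ContinuumYM3Torus.expectAt_eq_zero_of_odd_SU2` ('t Hooft 1979 §2 / McLerran–Svetitsky 1981 /
Bałaban CMP 109 (2.17): the fine centre twist is an
exact symmetry of the Wilson weight and of Haar measure, block averaging maps it to the unit twist,
the fundamental trace is odd) such a string has
expectation 0 at EVERY cut-off, so its sequence is constant. The rev-2 crux `UniformColdStartMixing`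
(24809, all strings) is banked as an aside: it
implies K_A1|Γ a fortiori (`neutral_of_uniform`, checked), and its three registered lines prove
K_A1|Γ verbatim.
Lean: `Summit.QuantumFields.YangMills.Theses.ColdStartUniversality.NeutralColdStartMixing ∧
Summit.QuantumFields.YangMills.Theses.ColdStartUniversality.ColdStartContinuumCauchy`

## Assembly
`closes` (glue.lean rev 3, kernel-checked, sorry-free): γ₁ from K_A1|Γ; for F, γ rewrite the leaf
body with `continuumYM3Torus_iff_hasContinuumLimit_SU F _
T4ApexTwoLevel.measurableE_expMeanLogSU hγ.le`; per loop string os: `by_cases ∃ μ, Odd (os.map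
(ULoop3.wind μ)).sum` — CHARGED: the sequence
`K ↦ expectAt K os` is identically 0 (`expectAt_eq_zero_of_odd_SU2`), limit 0; NEUTRAL
(`Int.not_odd_iff_even`): choose cold-start solutions from S
(one per K), let a K be their Cesàro values at the T of K_A1|Γ(δ = ε/4); K_A2 makes a Cauchy; K_A1|Γ
bounds |expectAt K os − a K| ≤ ε/4 for K ≥ K₀;
triangle inequality, `Metric.cauchySeq_iff`, `cauchySeq_tendsto_of_complete`. Pure logic + three
tree theorems.

CLOSES_TARGET: closes rung R3 of QuantumFields: Literature.MathematicalPhysics.QuantumFieldTheory.Balaban1983to89.T3YM3TorusStatement.YM3TorusSU2 (D-0061; not the summit Statement) — the deciding theorem of this route concludes that registered leaf instead of the Statement decl `YangMills` (class rung: servable and labelled, never counted as concluding the summit Statement).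

Rationale: WHY THIS LINE. Mechanism: uniqueness of the ultraviolet limit is obtained not by comparing
consecutive cut-off measures (the tilt/onset mechanism of every listed
route on this leaf: route-QuantumFields-UnitScaleTilt, route-QuantumFields-SmallFieldWidening, and
my own route-QuantumFields-OnsetCalibration on FC)
but by REFERRING EVERY CUT-OFF TO ONE DYNAMICAL OBJECT: the cold-start Langevin trajectory at
physical time T, whose block-averaged law should not
depend on K (K_A2, the 3-D analogue of the discrete-dynamics universality theorem of Chevyrev–Shen
arXiv:2302.12160 Thm 1.2/§1.1, which in 2-D
recovers the YM measure as the universal limit of lattice dynamics) and which forgets the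
cut-off-dependent equilibrium at a K-uniform rate in
physical time (K_A1; fixed cut-off: Shen–Zhu–Zhu arXiv:2204.12737 Lemma 3.2 + (1.6), tree
`LatticeLangevinWellPosedInvariant`; continuum d=3:
the local theory and gauge-covariant renormalisation of Chandra–Chevyrev–Hairer–Shen
arXiv:2201.03487 Thm 1.1, whose §1.2 names the invariant
measure / global existence as open). Imported from stochastic analysis: SPDE universality
(regularity structures), Krylov–Bogoliubov, coupling /
spectral-gap ergodicity of elliptic diffusions on compact Lie groups. Glue: two cut-offs K, K' are
both δ-close to their cold-start Cesàro values
(K_A1), which are δ-close to each other (K_A2) — so `expectAt K os` is Cauchy, `HasContinuumLimit`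
holds, and agreement/RP/covariance on SU(2)
are the tree theorem `continuumYM3Torus_iff_hasContinuumLimit_SU`. d = 3 is where stochastic
quantisation is SUBCRITICAL (barrier
`StochasticQuantisationCriticality` is a d = 4 statement), so this is the one rung of the ladder
where the SPDE programme can bear; no listed
route on R3 and no negatives-index entry uses a Markov dynamic. PRICE / THE BET (critic idea-crit-5
VERDICT #32, PASS-WITH-PRICE): K_A1 (cut-off-UNIFORM ergodicity of the 3-D YM Langevin dynamic from
a cold start in finite volume) and K_A2 (global solutions + Wilson-action discrete
regularity-structure convergence in d = 3) are each programme-sized (XL, open: CCHS arXiv:2201.03487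
§1.2 list global existence and the invariant measure at d = 3 as open) and plausibly HARDER than the
leaf they serve — the bet of this line is that the dynamic is the BETTER-POSED object (one
K-independent SPDE with a local solution theory, subcritical at d = 3), not the cheaper one; no
prover should be attached to K_A1/K_A2 before the toy of CHEAPEST FALSIFIER reports and the first
rung `stub_fixedCutoffMixing` lands. REV 3 (g7 LINE 6, «centre-sector reduction»; lever in five
words: centre superselection splits the leaf): the loop-string algebra of the leaf splits under the
EXACT Z₂³ electric centre symmetry of the finite periodic box into a CHARGED sector (odd total
winding in some direction), on which every cut-off expectation vanishes identically (tree
`T3ContinuumYM3Torus.expectAt_eq_zero_of_odd_SU2`, [tHooft1979Flux §2], [McLerranSvetitsky1981],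
[Balaban1987RG1 (2.17)]; [corpus:book:montvay1994-quantum-fields-lattice p.296],
[corpus:book:greensite2011-introduction-confinement-problem p.76]), and a NEUTRAL sector, where
alone the dynamics is asked to mix. Probabilistically this is LUMPING: the SZZ dynamics commutes
with the centre twists (central z: drift and left-invariant noise are equivariant), so on
centre-invariant observables it is the quotient Markov process on configurations modulo Z₂³, started
from the class of the 8 twisted classical vacua; the deterministic pay-off is that the charged third
of the instrument's attack surface (signed Polyakov lines, whose cold-start value +1 must be
symmetrised to 0 by excursions along the toron valley) is removed from the crux EXACTLY, not
estimated ([corpus:book:banisch2015-markov-chain-aggregation-agent-based-models p.95] lumpability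
under symmetry; no listed route's deciding theorem splits the leaf by centre charge — rg over
Theses/: centre symmetry appears only as a named FAILURE MODE of
route-QuantumFields-NoiseSynchronisation's crux, d = 4). HONESTY: the reduction does NOT remove the
slow toron-valley physics from the neutral sector (even products P(x)P(y) and |P̄|-type observables
still equilibrate by diffusion along the flat directions, heuristically in physical time O(ℓ/γ),
K-uniform); it removes the sign-symmetrisation step and every odd string, and it re-targets the
instrument (below).

RANKED CRUXES. #2 NeutralColdStartMixing (crux, rev 3) — K_A1|Γ — there is γ₁ > 0 such that for
every admissible family F, coupling 0 < γ ≤ γ₁, every loop string os with Σ_{C∈os} wind_μ C EVEN for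
μ = 0,1,2, and δ > 0 there are a PHYSICAL time T > 0 and K₀ with: for all K ≥ K₀ and every
cold-start strong solution U of the SZZ Langevin dynamics at β' = (γ ε_K)⁻¹/2 on the K-th lattice,
|expectAt K os − T⁻¹ ∫₀ᵀ E[∏_{C∈os} avgObs K C (U(s/ε_K))] ds| ≤ δ. [difficulty: open-problem] (why
it might fail: the neutral sector still contains the toron-valley observables (P(x)P(y), even
windings): their physical relaxation is valley diffusion, and the instrument of record (kit j298062,
REPORT-ym-csu-instr-1) saw |P̄| τ_int drift +0.69±0.05 over N = 8…24 at γ = 0.5 (flat at γ = 0.25);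
a K-growing τ_exp of an EVEN winding product at fixed γ kills it. Sources: arXiv:2204.12737,
arXiv:2201.03487, arXiv:2302.12160, doi:10.1017/cbo9780511470783, tHooft1979Flux,
McLerranSvetitsky1981.) #3 ColdStartContinuumCauchy (crux, unchanged) — K_A2 — finite-time
universality of the cold-start dynamics (lines birth / blocknoise_coupling / lindeberg_swap). ASIDE
(banked, rev 3): UniformColdStartMixing (24809, all strings) — implies #2 a fortiori; its registered
lines (birth, unitscale_coupling r2, cold_entropy r1.1) prove #2 verbatim with the parity hypothesis
discarded; never staffed on its own. SUPPORT: ColdStartSolutionsExist (proved p618112).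

KILL CRITERIA. refuted:NeutralColdStartMixing with a K-dependent lower bound on the physical
relaxation time of a CENTRE-NEUTRAL blocked observable (a contractible blocked loop, a product of
two Polyakov lines, or the free-field/Gaussian caricature showing T must grow with K) closes the
route outright; the rev-2 kill-shape «signed-Polyakov τ_exp growth» NO LONGER refutes anything
load-bearing (signed Polyakov strings are decided exactly) — the instrument row is re-targeted to
EVEN winding products P(x)P(y) and contractible unit loops: τ_exp in physical units growing with N
at fixed γ and not decreasing as γ↓; refuted:ColdStartContinuumCauchy (non-convergence of the
finite-time cold-start law) forces a pivot to a gauge-fixed lattice dynamic or closes it; a proof of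
YM3TorusSU2 by the tilt routes moots it; a refutation of stub_fixedCutoffMixing (wrong β'/plaquette
dictionary) is a MISSTATEMENT signal — repair β', not retire.

NOT DECOMPOSED YET. The uniform spectral gap / coupling construction behind K_A1 (which norm, which
coupling — synchronous-noise coupling of two cut-offs is NOT used here),
the a-priori bounds behind K_A2 (energy/Bakry–Émery on SU(2)^E vs regularity structures),
measurability/continuity of `avgObs` in the links
(stub_integrandRegular), and the identification wilsonMeasure(β_K/2) ↔ gibbs(β_K) under the bond
dictionary b ↦ (b.src, b.dir) — all layer-2. Rev 3: the lumping structure behind K_A1|Γ (pathwise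
twist-equivariance of SZZ solutions; mixing of the quotient process modulo Z₂³; the split of the
neutral sector into contractible strings (fast, local curvature) and even winding products (slow,
toron valley)) is layer-2 and goes into the birth skeleton of NeutralColdStartMixing, not into
items.

CHEAPEST FALSIFIER. Free-field (Gaussian, abelian) caricature of K_A1: lattice Langevin dφ = β_K
Δ_lat φ dt + √2 dB with β_K = (γε_K)⁻¹ relaxes the physical-momentum-p
mode at lattice rate β_K ε_K² p² = p² ε_K/γ, i.e. physical rate p²/γ after the rescaling t_lat =
t_phys/ε_K used in the statements — K-INDEPENDENT
(done by hand, passes; it fixes the time scaling: with t_lat = t_phys the crux is false, with t_lat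
= t_phys/ε_K² K_A2 would be the leaf in disguise).
Instrument row that would refute K_A1: integrated autocorrelation time of unit-physical-size blocked
Wilson loops in 3-D SU(2) lattice Langevin runs at
β = (γε)⁻¹, measured in physical units ε·τ_lat, growing with 1/ε (dynamical exponent z > 2;
Montvay–Münster (7.42) p.367, §7.5.2 pp.393–397, §7.6 p.403).

NUMBERS. β_K = (γ ε_K)⁻¹ with ε_K = L^(−K) (Bałaban `Params.eps`, T.3 (3)); SZZ coupling β' = β_K/2
because Bałaban's `reTr = Re Tr/2` on SU(2) and SZZ's
`wilsonAction` uses the unnormalised `Re Tr` over the same plaquette set (src, μ<ν); lattice time =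
physical time/ε_K (metric ε^(d−2)·HS, d = 3);
free-field physical relaxation rate of momentum p: p²/γ; Chevyrev–Shen universality is d = 2
(arXiv:2302.12160), CCHS local theory d = 3 (arXiv:2201.03487).

DEFINITION REQUESTS. None: all items are typed over `T3ContinuumYM3Torus.T3Family`,
`Missing.TorusScheme.expectAt`, `latticeLangevinDynamics`, `LinkSDE.IsSolution`,
`IsFlatBrownian` (tree). A continuum state space for 3-D Yang–Mills (Cao–Chatterjee
arXiv:2111.12813) is deliberately NOT requested — the line is typed lattice-side. TOY RUN (kit job
j297562, submitted 2026-08-28T02:34Z, one batch): 3-D SU(2) Langevin on L³, L ∈ {6,8,12,16,20}, β =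
L/γ (γ = 1), cold start, geodesic Euler–Maruyama; measures τ_int and cold-start relaxation times, in
PHYSICAL time t_lat/L, of the spatially averaged Polyakov loops (toron coordinates), their squares,
|P|, the lowest plaquette Fourier mode and the plaquette; K-uniformity ⇔ τ_phys roughly
L-independent; result attached as evidence on stmt-QuantumFields-24809 when the job ends. Rev 3
CHEAPEST FALSIFIER of the reduction itself: none needed — the charged-sector vanishing is a tree
theorem (expectAt_eq_zero_of_odd_SU2, kernel-checked); cheapest falsifier of K_A1|Γ: the re-targeted
instrument row (τ_exp of P(x)P(y) and of a contractible blocked loop vs N at γ ∈ {0.25, 0.5}, same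
engine as kit j298062).

Novelty: Searches (2026-08-28): lean `rg Langevin|IsSolution Summits/QuantumFields/YangMills/Theses`
(Langevin appears only in d = 4 routes NoiseSynchronisation,
LangevinControlUV, FlowLineStateSpace — none on leaf R3, none with a cold-start/ergodicity lever);
`ledger negatives --problem QuantumFields` (7 entries, none
dynamical); lit search --hybrid "Yang-Mills Langevin dynamic invariant measure universality lattice
approximation" (8 docs: [corpus:book:montvay1994-quantum-fields-lattice
p.393] Langevin algorithms, no theorem); lit vsearch (8 docs, Kipnis–Landim/Montvay, nothing on YM
ergodicity); lit galaxy search "Yang-Mills Langevin|stochastic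
Yang-Mills|Yang-Mills heat bath" --star all (7 pdf hits: [galaxy:pdf:8767155008312693080] OWR
59/2023 AG QFT and SPDEs, [galaxy:pdf:498107234074418080] OWR 54/2023;
0 panama, 0 crabby); arXiv reads arXiv:2111.12813 (pp.6–7 Conj. 6/11), arXiv:2201.03487 (p.6 open
problems), arXiv:2302.12160 (p.4 method); OpenAlex/S2 rate-limited (429).
Nearest prior art found: arXiv:2302.12160 (Chevyrev–Shen: 2-D YM measure as universal limit of
lattice dynamics, invariant measure) and arXiv:2201.03487 (CCHS: 3-D local
SPDE, open problem of the invariant measure); in-tree nearest: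
route-QuantumFields-NoiseSynchronisation (d = 4, synchronous coupling for a mass gap, not uniqueness
of a UV limit).
Delta: transplants the Chevyrev–Shen «measure = universal limit of the dynamic» mechanism from d = 2
to Bałaban's d = 3 torus limit and splits it into a
cut-off-unifor  [refs: 2111.12813, 2201.03487, 2302.12160, book:montvay1994-quantum-fields-lattice, book:greensite2011-introduction-confinement-problem, book:banisch2015-markov-chain-aggregation-agent-based-models, McLerranSvetitsky1981]

Barriers (technique_class: stochastic-quantisation, langevin-ergodicity): - technique_class: stochastic-quantisation, langevin-ergodicity
- Literature.Barriers.QuantumFields.StochasticQuantisationCriticality: outside — the barrier is the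
d = 4 criticality of the YM SPDE; this line lives at d = 3 (rung R3), where the equation is
subcritical and the local theory exists (arXiv:2201.03487 Thm 1.1); the bet is only on
GLOBAL/uniform-in-cut-off control.
- Literature.Barriers.QuantumFields.UVStabilityNonUniqueness: this is the barrier the line addresses
head-on — UV stability (Bałaban) gives existence of limit points but not uniqueness; the «other
input» supplied is dynamical (K_A1 + K_A2), not a finer stability bound; it does not evade it, it is
the bet.
- Negatives index: empty of dynamical statements at filing (7 entries:
regulator/threshold/fermion-block statements); none is used or restated.
- Rev 3: the centre-sector reduction is exact symmetry bookkeeping ('t Hooft flux sectors); it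
touches no catalogued barrier and does not change the placement above; negatives index re-read
2026-08-28 (no dynamical or centre-symmetry statement).

sub-problem: YangMills · status: open · opened planner-ym-idea-5-g3-0 2026-08-28T02:22:07Z · rev 6 · ledger route-QuantumFields-ColdStartUniversality
GENERATED by the gate from the ledger (D-0016/17). Provers cite these decls: `theorem foo : Summit.QuantumFields.YangMills.Theses.ColdStartUniversality.<Decl> := …` in Summits/QuantumFields/YangMills/Theorems/<Name>.lean.
-/

namespace Summit.QuantumFields.YangMills.Theses.ColdStartUniversality

open scoped BigOperators Topology Manifold Classical MeasureTheory ProbabilityTheory Matrix InnerProductSpace ComplexConjugate ContinuousMap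
open Filter Set Function TopologicalSpace MeasureTheory

attribute [summit_statement] _root_.YangMills
attribute [summit_statement] _root_.Literature.MathematicalPhysics.QuantumFieldTheory.Balaban1983to89.T3YM3TorusStatement.YM3TorusSU2

/-- item stmt-QuantumFields-27363 · crux · rank 2 · open · by planner
why it might fail: T is chosen BEFORE K (∃T ∃K₀ ∀K≥K₀): the load-bearing claim is K-uniformity of the neutral-sector mixing time. Kill-shape (V80): physical τ_exp of the NEUTRAL Polyakov pair P(x)P(y) growing with N (e.g. exp(cN)) at fixed γ∈{0.25,0.5}; toron-valley diffusion of even winding products is the suspect.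
sources: arXiv:2204.12737, arXiv:2201.03487, arXiv:2302.12160, doi:10.1017/cbo9780511470783, tHooft1979Flux, McLerranSvetitsky1981
[crux] K_A1|Γ (rev 3, LINE «centre-sector reduction») — there is γ₁ > 0 such that for every
admissible family F, coupling 0 < γ ≤ γ₁, every loop string os whose winding numbers add up to an
EVEN number in each direction μ = 0,1,2 (the sector invariant under the Z₂³ electric centre twists)
and every δ > 0 there are a PHYSICAL time T > 0 and K₀ with: for all K ≥ K₀ and every cold-start
strong solution U of the SZZ Langevin dynamics at β' = (γ ε_K)⁻¹/2 on the K-th lattice (any filtered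
probability space, any flat Brownian driver), |expectAt K os − T⁻¹ ∫₀ᵀ E[∏_{C∈os} avgObs K C
(U(s/ε_K))] ds| ≤ δ. Cut-off-uniform relaxation of the LUMPED (mod-centre) cold-start dynamics, seen
by centre-neutral unit-scale block-averaged loop strings; charged strings need no dynamics (exact
vanishing). Implied a fortiori by UniformColdStartMixing (24809). -/
@[route_item "route-QuantumFields-ColdStartUniversality", crux]
def NeutralColdStartMixing : Prop :=
  ∃ γ₁ : ℝ, 0 < γ₁ ∧ ∀ (F : Literature.MathematicalPhysics.QuantumFieldTheory.Balaban1983to89.T3ContinuumYM3Torus.T3Family) (γ : ℝ), 0 < γ → γ ≤ γ₁ → ∀ (os : List (Literature.MathematicalPhysics.QuantumFieldTheory.Balaban1983to89.T3ContinuumYM3Torus.ULoop3 F)), (∀ μ : Fin 3, Even (os.map (Literature.MathematicalPhysics.QuantumFieldTheory.Balaban1983to89.T3ContinuumYM3Torus.ULoop3.wind μ)).sum) → ∀ (δ : ℝ), 0 < δ → ∃ T : ℝ, 0 < T ∧ ∃ K₀ : ℕ, ∀ K : ℕ, K₀ ≤ K → ∀ (Ω : Type) (mΩ : MeasurableSpace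 Ω) (P : MeasureTheory.Measure Ω) (hP : MeasureTheory.IsProbabilityMeasure P) (W : NNReal → Ω → (Literature.MathematicalPhysics.QuantumFieldTheory.Edge 3 ((F.P K).sitesPerDir 0) × Literature.MathematicalPhysics.QuantumFieldTheory.NoiseIdx 2 → ℝ)) (hW : Literature.MathematicalPhysics.QuantumFieldTheory.IsFlatBrownian W P) (U : NNReal → Ω → Literature.MathematicalPhysics.QuantumFieldTheory.GaugeConfig 3 ((F.P K).sitesPerDir 0) (Matrix.specialUnitaryGroup (Fin 2) ℂ)), (∀ ω, U 0 ω = fun _ => 1) → (Literature.MathematicalPhysics.QuantumFieldTheory.latticeLangevinDynamics (⟨2, Literature.MathematicalPhysics.QuantumLattice.fundamentalRep (Fin 2), Literature.MathematicalPhysics.QuantumLattice.continuous_fundamentalRep _, Literature.MathematicalPhysics.QuantumLattice.fundamentalRep_injective _, Literature.MathematicalPhysics.QuantumLattice.fundamentalRep_mem_unitaryGroup⟩ : Literature.MathematicalPhysics.QuantumFieldTheory.LatticeRep (Matrix.specialUnitaryGroup (Fin 2) ℂ)) ((γ * (F.P K).eps)⁻¹ / 2)).IsSolution (Literature.MathematicalPhysics.QuantumLattice.fundamentalRep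 (Fin 2)) hW.natFiltration P W U → |(F.scheme (Literature.MathematicalPhysics.QuantumFieldTheory.Balaban1983to89.ExpMeanLog.expMeanLogSU : Literature.MathematicalPhysics.QuantumFieldTheory.Balaban1983to89.LoopAverage (Matrix.specialUnitaryGroup (Fin 2) ℂ)) γ).expectAt K os - T⁻¹ * intervalIntegral (fun s : ℝ => MeasureTheory.integral P (fun ω => (os.map fun C => F.avgObs (Literature.MathematicalPhysics.QuantumFieldTheory.Balaban1983to89.ExpMeanLog.expMeanLogSU : Literature.MathematicalPhysics.QuantumFieldTheory.Balaban1983to89.LoopAverage (Matrix.specialUnitaryGroup (Fin 2) ℂ)) K C (fun b : Literature.MathematicalPhysics.QuantumFieldTheory.Balaban1983to89.PBond (F.P K) 0 => U (s / (F.P K).eps).toNNReal ω (b.src, b.dir))).prod)) 0 T MeasureTheory.volume| ≤ δ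

/-- item stmt-QuantumFields-24810 · crux · rank 3 · open · by planner
why it might fail: needs GLOBAL-in-time control of the 3-D lattice dynamics uniformly in K (CCHS have only local solutions; blow-up of the SPDE before time T/finite-K divergence of renormalised drift) and a 3-D discrete regularity-structure convergence for the Wilson action that is not in print.
sources: arXiv:2201.03487, arXiv:2302.12160, arXiv:2204.12737
[crux] K_A2 — for every F, γ > 0, loop string os, physical time T > 0 and any sequence a with a K =
the cold-start physical-time Cesàro mean at step K computed in SOME cold-start strong solution (one
per K), a is Cauchy. Finite-time universality: the law of the block-averaged loop observables under
the cold-start dynamics at physical times ≤ T has a K → ∞ limit independent of the realisations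
(weak uniqueness included). [difficulty: open-problem] -/
@[route_item "route-QuantumFields-ColdStartUniversality", crux]
def ColdStartContinuumCauchy : Prop :=
  ∀ (F : Literature.MathematicalPhysics.QuantumFieldTheory.Balaban1983to89.T3ContinuumYM3Torus.T3Family) (γ : ℝ), 0 < γ → ∀ (os : List (Literature.MathematicalPhysics.QuantumFieldTheory.Balaban1983to89.T3ContinuumYM3Torus.ULoop3 F)) (T : ℝ), 0 < T → ∀ (a : ℕ → ℝ), (∀ K : ℕ, ∃ (Ω : Type) (_mΩ : MeasurableSpace Ω) (P : MeasureTheory.Measure Ω) (_hP : MeasureTheory.IsProbabilityMeasure P) (W : NNReal → Ω → (Literature.MathematicalPhysics.QuantumFieldTheory.Edge 3 ((F.P K).sitesPerDir 0) × Literature.MathematicalPhysics.QuantumFieldTheory.NoiseIdx 2 → ℝ)) (hW : Literature.MathematicalPhysics.QuantumFieldTheory.IsFlatBrownian W P) (U : NNReal → Ω → Literature.MathematicalPhysics.QuantumFieldTheory.GaugeConfig 3 ((F.P K).sitesPerDir 0) (Matrix.specialUnitaryGroup (Fin 2) ℂ)), (∀ ω, U 0 ω = fun _ => 1) ∧ (Literature.MathematicalPhysics.QuantumFieldTheory.latticeLangevinDynamics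 (⟨2, Literature.MathematicalPhysics.QuantumLattice.fundamentalRep (Fin 2), Literature.MathematicalPhysics.QuantumLattice.continuous_fundamentalRep _, Literature.MathematicalPhysics.QuantumLattice.fundamentalRep_injective _, Literature.MathematicalPhysics.QuantumLattice.fundamentalRep_mem_unitaryGroup⟩ : Literature.MathematicalPhysics.QuantumFieldTheory.LatticeRep (Matrix.specialUnitaryGroup (Fin 2) ℂ)) ((γ * (F.P K).eps)⁻¹ / 2)).IsSolution (Literature.MathematicalPhysics.QuantumLattice.fundamentalRep (Fin 2)) hW.natFiltration P W U ∧ a K = T⁻¹ * intervalIntegral (fun s : ℝ => MeasureTheory.integral P (fun ω => (os.map fun C => F.avgObs (Literature.MathematicalPhysics.QuantumFieldTheory.Balaban1983to89.ExpMeanLog.expMeanLogSU : Literature.MathematicalPhysics.QuantumFieldTheory.Balaban1983to89.LoopAverage (Matrix.specialUnitaryGroup (Fin 2) ℂ)) K C (fun b : Literature.MathematicalPhysics.QuantumFieldTheory.Balaban1983to89.PBond (F.P K) 0 => U (s / (F.P K).eps).toNNReal ω (b.src, b.dir))).prod)) 0 T MeasureTheory.volume) → CauchySeq a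

/-- item stmt-QuantumFields-24809 · aside · rank 2 · open · by planner
why it might fail: unit-scale relaxation time may grow with K (z > 2, slow gauge/topological modes). FLAGGED (instr j298062): WINDING (Polyakov) sector — |P̄| τ_int +0.69±0.05 in N at γ=0.5 (τ_exp flat), flat at γ=0.25; ULoop3 includes winding words: kill-shape = signed-Polyakov τ_exp growth not decreasing as γ↓.
sources: arXiv:2204.12737, arXiv:2201.03487, arXiv:2302.12160, doi:10.1017/cbo9780511470783
[crux] K_A1 — there is γ₁ > 0 such that for every admissible family F, coupling 0 < γ ≤ γ₁, loop
string os and δ > 0 there are a PHYSICAL time T > 0 and K₀ with: for all K ≥ K₀ and every cold-start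
strong solution U of the SZZ Langevin dynamics at β' = (γ ε_K)⁻¹/2 on the K-th lattice (any filtered
probability space, any flat Brownian driver), |expectAt K os − T⁻¹ ∫₀ᵀ E[∏_{C∈os} avgObs K C
(U(s/ε_K))] ds| ≤ δ. Cut-off-uniform relaxation to Bałaban's Gibbs state in physical time, seen by
unit-scale block-averaged loops. [difficulty: open-problem] -/
@[route_item "route-QuantumFields-ColdStartUniversality", crux]
def UniformColdStartMixing : Prop :=
  ∃ γ₁ : ℝ, 0 < γ₁ ∧ ∀ (F : Literature.MathematicalPhysics.QuantumFieldTheory.Balaban1983to89.T3ContinuumYM3Torus.T3Family) (γ : ℝ), 0 < γ → γ ≤ γ₁ → ∀ (os : List (Literature.MathematicalPhysics.QuantumFieldTheory.Balaban1983to89.T3ContinuumYM3Torus.ULoop3 F)) (δ : ℝ), 0 < δ → ∃ T : ℝ, 0 < T ∧ ∃ K₀ : ℕ, ∀ K : ℕ, K₀ ≤ K → ∀ (Ω : Type) (mΩ : MeasurableSpace Ω) (P : MeasureTheory.Measure Ω) (hP : MeasureTheory.IsProbabilityMeasure P) (W : NNReal → Ω → (Literature.MathematicalPhysics.QuantumFieldTheory.Edge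 3 ((F.P K).sitesPerDir 0) × Literature.MathematicalPhysics.QuantumFieldTheory.NoiseIdx 2 → ℝ)) (hW : Literature.MathematicalPhysics.QuantumFieldTheory.IsFlatBrownian W P) (U : NNReal → Ω → Literature.MathematicalPhysics.QuantumFieldTheory.GaugeConfig 3 ((F.P K).sitesPerDir 0) (Matrix.specialUnitaryGroup (Fin 2) ℂ)), (∀ ω, U 0 ω = fun _ => 1) → (Literature.MathematicalPhysics.QuantumFieldTheory.latticeLangevinDynamics (⟨2, Literature.MathematicalPhysics.QuantumLattice.fundamentalRep (Fin 2), Literature.MathematicalPhysics.QuantumLattice.continuous_fundamentalRep _, Literature.MathematicalPhysics.QuantumLattice.fundamentalRep_injective _, Literature.MathematicalPhysics.QuantumLattice.fundamentalRep_mem_unitaryGroup⟩ : Literature.MathematicalPhysics.QuantumFieldTheory.LatticeRep (Matrix.specialUnitaryGroup (Fin 2) ℂ)) ((γ * (F.P K).eps)⁻¹ / 2)).IsSolution (Literature.MathematicalPhysics.QuantumLattice.fundamentalRep (Fin 2)) hW.natFiltration P W U → |(F.scheme (Literature.MathematicalPhysics.QuantumFieldTheory.Balaban1983to89.ExpMeanLog.expMeanLogSU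 : Literature.MathematicalPhysics.QuantumFieldTheory.Balaban1983to89.LoopAverage (Matrix.specialUnitaryGroup (Fin 2) ℂ)) γ).expectAt K os - T⁻¹ * intervalIntegral (fun s : ℝ => MeasureTheory.integral P (fun ω => (os.map fun C => F.avgObs (Literature.MathematicalPhysics.QuantumFieldTheory.Balaban1983to89.ExpMeanLog.expMeanLogSU : Literature.MathematicalPhysics.QuantumFieldTheory.Balaban1983to89.LoopAverage (Matrix.specialUnitaryGroup (Fin 2) ℂ)) K C (fun b : Literature.MathematicalPhysics.QuantumFieldTheory.Balaban1983to89.PBond (F.P K) 0 => U (s / (F.P K).eps).toNNReal ω (b.src, b.dir))).prod)) 0 T MeasureTheory.volume| ≤ δ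

/-- item stmt-QuantumFields-24811 · support · rank 9 · closed · proved by Summit.QuantumFields.YangMills.Theorems.ColdStartSolutionsExist_proof (prover) · by planner
sources: arXiv:2204.12737
[support] S — for every F, γ > 0 and K there is a filtered probability space carrying a flat
Brownian motion and a cold-start strong solution of the SZZ lattice Langevin SDE at β' = (γ ε_K)⁻¹/2
(Shen–Zhu–Zhu Lemma 3.2: globally Lipschitz coefficients on the compact group; plus existence of a
Brownian family). [difficulty: M] -/
@[route_item "route-QuantumFields-ColdStartUniversality", crux]
def ColdStartSolutionsExist : Prop :=
  ∀ (F : Literature.MathematicalPhysics.QuantumFieldTheory.Balaban1983to89.T3ContinuumYM3Torus.T3Family) (γ : ℝ) (K : ℕ), 0 < γ → ∃ (Ω : Type) (_mΩ : MeasurableSpace Ω) (P : MeasureTheory.Measure Ω) (_hP : MeasureTheory.IsProbabilityMeasure P) (W : NNReal → Ω → (Literature.MathematicalPhysics.QuantumFieldTheory.Edge 3 ((F.P K).sitesPerDir 0) × Literature.MathematicalPhysics.QuantumFieldTheory.NoiseIdx 2 → ℝ)) (hW : Literature.MathematicalPhysics.QuantumFieldTheory.IsFlatBrownian W P) (U :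 NNReal → Ω → Literature.MathematicalPhysics.QuantumFieldTheory.GaugeConfig 3 ((F.P K).sitesPerDir 0) (Matrix.specialUnitaryGroup (Fin 2) ℂ)), (∀ ω, U 0 ω = fun _ => 1) ∧ (Literature.MathematicalPhysics.QuantumFieldTheory.latticeLangevinDynamics (⟨2, Literature.MathematicalPhysics.QuantumLattice.fundamentalRep (Fin 2), Literature.MathematicalPhysics.QuantumLattice.continuous_fundamentalRep _, Literature.MathematicalPhysics.QuantumLattice.fundamentalRep_injective _, Literature.MathematicalPhysics.QuantumLattice.fundamentalRep_mem_unitaryGroup⟩ : Literature.MathematicalPhysics.QuantumFieldTheory.LatticeRep (Matrix.specialUnitaryGroup (Fin 2) ℂ)) ((γ * (F.P K).eps)⁻¹ / 2)).IsSolution (Literature.MathematicalPhysics.QuantumLattice.fundamentalRep (Fin 2)) hW.natFiltration P W U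

-- `ColdStartSolutionsExist` holds: proved by `Summit.QuantumFields.YangMills.Theorems.ColdStartSolutionsExist_proof` (its module imports this route file, so no `_holds` link can be stated here).

/-- item stmt-QuantumFields-27403 · support · rank 9 · open · by planner
why it might fail: K-uniform fibre equilibration is still a UV-uniform mixing claim (all transverse modes, incl. unit-scale non-Gaussian ones and the light non-abelian constant modes near the 8 orbifold points of the valley); at fixed γ the adiabatic error O(γℓ) is absorbed only by the δ-slack per unit time.
sources: doi:10.1016/c2013-0-15235-x, doi:10.1007/978-3-642-25847-3, doi:10.1007/978-0-387-73829-1, doi:10.1016/0550-3213(83)90436-4, doi:10.1016/0003-4916(87)90032-5, arXiv:2204.12737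
[line «valley_averaging» on NeutralColdStartMixing (27363), stub 1, XL] ADIABATIC VALLEY TRACKING:
for every centre-neutral loop string os and δ>0 there are a burn-in cost c ≥ 0 and K₀ such that for
all K ≥ K₀, along EVERY cold-start SZZ-Langevin solution at β′ = (γ ε_K)⁻¹/2, the time integrals
over [0,T] of E[∏os(U_s)] and of E[vproj_K(U_s)] differ by at most δ·T + c for all T > 0, where
vproj_K := the Gibbs conditional expectation (Mathlib condExp, a pinned version) of the string
observable given the σ-algebra generated by the VALLEY COORDINATE (the vector of block-averaged
SU(2) Polyakov lines in the three directions, averaged over base points). Physics: the fast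
(non-valley) modes relax at rate ≥ 4π²/(γℓ²) and track the slowly diffusing valley coordinate
adiabatically (time-scale separation parameter γℓ/4π²); the content is that the fibre-equilibration
time is uniform in the cut-off. Implied by nothing in the tree; with ValleyCesaroMixing it gives the
crux (composition kernel-checked in the registered skeleton). -/
@[route_item "route-QuantumFields-ColdStartUniversality", crux]
def AdiabaticValleyTracking : Prop :=
  ∃ γ₁ : ℝ, 0 < γ₁ ∧ ∀ (F : Literature.MathematicalPhysics.QuantumFieldTheory.Balaban1983to89.T3ContinuumYM3Torus.T3Family) (γ : ℝ), 0 < γ → γ ≤ γ₁ → ∀ (os : List (Literature.MathematicalPhysics.QuantumFieldTheory.Balaban1983to89.T3ContinuumYM3Torus.ULoop3 F)), (∀ μ : Fin 3, Even (os.map (Literature.MathematicalPhysics.QuantumFieldTheory.Balaban1983to89.T3ContinuumYM3Torus.ULoop3.wind μ)).sum) → ∀ (δ : ℝ), 0 < δ → ∃ c : ℝ, 0 ≤ c ∧ ∃ K₀ : ℕ, ∀ K : ℕ, K₀ ≤ K → ∀ (Ω : Type) (mΩ : MeasurableSpace Ω) (P : MeasureTheory.Measure Ω) (hP : MeasureTheory.IsProbabilityMeasure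 P) (W : NNReal → Ω → (Literature.MathematicalPhysics.QuantumFieldTheory.Edge 3 ((F.P K).sitesPerDir 0) × Literature.MathematicalPhysics.QuantumFieldTheory.NoiseIdx 2 → ℝ)) (hW : Literature.MathematicalPhysics.QuantumFieldTheory.IsFlatBrownian W P) (U : NNReal → Ω → Literature.MathematicalPhysics.QuantumFieldTheory.GaugeConfig 3 ((F.P K).sitesPerDir 0) (Matrix.specialUnitaryGroup (Fin 2) ℂ)), (∀ ω, U 0 ω = fun _ => 1) → (Literature.MathematicalPhysics.QuantumFieldTheory.latticeLangevinDynamics (⟨2, Literature.MathematicalPhysics.QuantumLattice.fundamentalRep (Fin 2), Literature.MathematicalPhysics.QuantumLattice.continuous_fundamentalRep _, Literature.MathematicalPhysics.QuantumLattice.fundamentalRep_injective _, Literature.MathematicalPhysics.QuantumLattice.fundamentalRep_mem_unitaryGroup⟩ : Literature.MathematicalPhysics.QuantumFieldTheory.LatticeRep (Matrix.specialUnitaryGroup (Fin 2) ℂ)) ((γ * (F.P K).eps)⁻¹ / 2)).IsSolution (Literature.MathematicalPhysics.QuantumLattice.fundamentalRep (Fin 2)) hW.natFiltration P W U → ∀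 (T : ℝ), 0 < T → |intervalIntegral (fun s : ℝ => MeasureTheory.integral P (fun ω => (MeasureTheory.condExp (MeasurableSpace.comap (fun (V : Literature.MathematicalPhysics.QuantumFieldTheory.Balaban1983to89.GaugeField (F.P K) 0 (Matrix.specialUnitaryGroup (Fin 2) ℂ)) (μ : Fin 3) => (Fintype.card F.USite : ℝ)⁻¹ * ∑ x : F.USite, F.avgObs (Literature.MathematicalPhysics.QuantumFieldTheory.Balaban1983to89.ExpMeanLog.expMeanLogSU : Literature.MathematicalPhysics.QuantumFieldTheory.Balaban1983to89.LoopAverage (Matrix.specialUnitaryGroup (Fin 2) ℂ)) K (Literature.MathematicalPhysics.QuantumFieldTheory.Balaban1983to89.T3ContinuumYM3Torus.ULoop3.polyakov μ x) V) MeasurableSpace.pi) (Literature.MathematicalPhysics.QuantumFieldTheory.Balaban1983to89.T4GenFunBounds.gibbsMeasure (G := Matrix.specialUnitaryGroup (Fin 2) ℂ) (F.P K) ((F.scheme (Literature.MathematicalPhysics.QuantumFieldTheory.Balaban1983to89.ExpMeanLog.expMeanLogSU : Literature.MathematicalPhysics.QuantumFieldTheory.Balaban1983to89.LoopAverage (Matrix.specialUnitaryGroup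 (Fin 2) ℂ)) γ).β K)) (fun V : Literature.MathematicalPhysics.QuantumFieldTheory.Balaban1983to89.GaugeField (F.P K) 0 (Matrix.specialUnitaryGroup (Fin 2) ℂ) => (os.map fun C => F.avgObs (Literature.MathematicalPhysics.QuantumFieldTheory.Balaban1983to89.ExpMeanLog.expMeanLogSU : Literature.MathematicalPhysics.QuantumFieldTheory.Balaban1983to89.LoopAverage (Matrix.specialUnitaryGroup (Fin 2) ℂ)) K C V).prod)) (fun b : Literature.MathematicalPhysics.QuantumFieldTheory.Balaban1983to89.PBond (F.P K) 0 => U (s / (F.P K).eps).toNNReal ω (b.src, b.dir)))) 0 T MeasureTheory.volume - intervalIntegral (fun s : ℝ => MeasureTheory.integral P (fun ω => (os.map fun C => F.avgObs (Literature.MathematicalPhysics.QuantumFieldTheory.Balaban1983to89.ExpMeanLog.expMeanLogSU : Literature.MathematicalPhysics.QuantumFieldTheory.Balaban1983to89.LoopAverage (Matrix.specialUnitaryGroup (Fin 2) ℂ)) K C (fun b : Literature.MathematicalPhysics.QuantumFieldTheory.Balaban1983to89.PBond (F.P K) 0 => U (s / (F.P K).eps).toNNReal ω (b.src, b.dir))).prod))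 0 T MeasureTheory.volume| ≤ δ * T + c

/-- item stmt-QuantumFields-27404 · support · rank 9 · open · by planner
why it might fail: The valley process is not Markov at fixed γ; K-uniform TV mixing of a 3-dim projection still needs control of the full dynamics' return times to the valley neighbourhood, and tunnelling between Weyl/centre images of the valley may be slow in ℓ (fine: ℓ is fixed) but must be K-uniform.
sources: doi:10.1016/c2013-0-15235-x, doi:10.1007/978-3-642-25847-3, doi:10.1016/0550-3213(83)90436-4, doi:10.1016/0003-4916(87)90032-5, arXiv:2204.12737, arXiv:2201.03487
[line «valley_averaging» on NeutralColdStartMixing (27363), stub 2, XL] VALLEY CESÀRO MIXING: for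
every δ>0 there are a physical time T₀ and K₀ such that for all K ≥ K₀, every bounded (|h| ≤ 1
Gibbs-a.e.) function h measurable w.r.t. the σ-algebra of the valley coordinate, and every
cold-start solution, |∫ h dGibbs_K − T⁻¹∫₀ᵀ E[h(U_s)] ds| ≤ δ for all T ≥ T₀: the Cesàro law of the
3-dimensional valley coordinate (moduli of flat connections T³/Weyl seen through block-averaged
Polyakov lines) reaches its Gibbs marginal in total variation after a cut-off-independent time.
Physics: valley diffusion coefficient ~1/ℓ (γ-independent), one-loop effective potential of the
constant modes (Lüscher); as γℓ→0 the projected process is an autonomous diffusion on the orbifold.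
The low-dimensional half of the slow–fast split. -/
@[route_item "route-QuantumFields-ColdStartUniversality"]
def ValleyCesaroMixing : Prop :=
  ∃ γ₁ : ℝ, 0 < γ₁ ∧ ∀ (F : Literature.MathematicalPhysics.QuantumFieldTheory.Balaban1983to89.T3ContinuumYM3Torus.T3Family) (γ : ℝ), 0 < γ → γ ≤ γ₁ → ∀ (δ : ℝ), 0 < δ → ∃ T₀ : ℝ, 0 < T₀ ∧ ∃ K₀ : ℕ, ∀ K : ℕ, K₀ ≤ K → ∀ (h : Literature.MathematicalPhysics.QuantumFieldTheory.Balaban1983to89.GaugeField (F.P K) 0 (Matrix.specialUnitaryGroup (Fin 2) ℂ) → ℝ), @MeasureTheory.StronglyMeasurable _ _ _ (MeasurableSpace.comap (fun (V : Literature.MathematicalPhysics.QuantumFieldTheory.Balaban1983to89.GaugeField (F.P K) 0 (Matrix.specialUnitaryGroup (Fin 2) ℂ)) (μ : Fin 3) => (Fintype.card F.USite : ℝ)⁻¹ * ∑ x : F.USite, F.avgObs (Literature.MathematicalPhysics.QuantumFieldTheory.Balaban1983to89.ExpMeanLog.expMeanLogSU : Literature.MathematicalPhysics.QuantumFieldTheory.Balaban1983to89.LoopAverage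 (Matrix.specialUnitaryGroup (Fin 2) ℂ)) K (Literature.MathematicalPhysics.QuantumFieldTheory.Balaban1983to89.T3ContinuumYM3Torus.ULoop3.polyakov μ x) V) MeasurableSpace.pi) h → (∀ᵐ V ∂(Literature.MathematicalPhysics.QuantumFieldTheory.Balaban1983to89.T4GenFunBounds.gibbsMeasure (G := Matrix.specialUnitaryGroup (Fin 2) ℂ) (F.P K) ((F.scheme (Literature.MathematicalPhysics.QuantumFieldTheory.Balaban1983to89.ExpMeanLog.expMeanLogSU : Literature.MathematicalPhysics.QuantumFieldTheory.Balaban1983to89.LoopAverage (Matrix.specialUnitaryGroup (Fin 2) ℂ)) γ).β K)), |h V| ≤ 1) → ∀ (Ω : Type) (mΩ : MeasurableSpace Ω) (P : MeasureTheory.Measure Ω) (hP : MeasureTheory.IsProbabilityMeasure P) (W : NNReal → Ω → (Literature.MathematicalPhysics.QuantumFieldTheory.Edge 3 ((F.P K).sitesPerDir 0) × Literature.MathematicalPhysics.QuantumFieldTheory.NoiseIdx 2 → ℝ)) (hW : Literature.MathematicalPhysics.QuantumFieldTheory.IsFlatBrownian W P) (U : NNReal → Ω → Literature.MathematicalPhysics.QuantumFieldTheory.GaugeConfig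 3 ((F.P K).sitesPerDir 0) (Matrix.specialUnitaryGroup (Fin 2) ℂ)), (∀ ω, U 0 ω = fun _ => 1) → (Literature.MathematicalPhysics.QuantumFieldTheory.latticeLangevinDynamics (⟨2, Literature.MathematicalPhysics.QuantumLattice.fundamentalRep (Fin 2), Literature.MathematicalPhysics.QuantumLattice.continuous_fundamentalRep _, Literature.MathematicalPhysics.QuantumLattice.fundamentalRep_injective _, Literature.MathematicalPhysics.QuantumLattice.fundamentalRep_mem_unitaryGroup⟩ : Literature.MathematicalPhysics.QuantumFieldTheory.LatticeRep (Matrix.specialUnitaryGroup (Fin 2) ℂ)) ((γ * (F.P K).eps)⁻¹ / 2)).IsSolution (Literature.MathematicalPhysics.QuantumLattice.fundamentalRep (Fin 2)) hW.natFiltration P W U → ∀ (T : ℝ), T₀ ≤ T → |∫ V, h V ∂(Literature.MathematicalPhysics.QuantumFieldTheory.Balaban1983to89.T4GenFunBounds.gibbsMeasure (G := Matrix.specialUnitaryGroup (Fin 2) ℂ) (F.P K) ((F.scheme (Literature.MathematicalPhysics.QuantumFieldTheory.Balaban1983to89.ExpMeanLog.expMeanLogSU : Literature.MathematicalPhysics.QuantumFieldTheory.Balaban1983to89.LoopAverage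 (Matrix.specialUnitaryGroup (Fin 2) ℂ)) γ).β K)) - T⁻¹ * intervalIntegral (fun s : ℝ => MeasureTheory.integral P (fun ω => h (fun b : Literature.MathematicalPhysics.QuantumFieldTheory.Balaban1983to89.PBond (F.P K) 0 => U (s / (F.P K).eps).toNNReal ω (b.src, b.dir)))) 0 T MeasureTheory.volume| ≤ δ

/-- item stmt-QuantumFields-24812 · assembly · rank 1 · closed · proved by Summit.QuantumFields.YangMills.Theorems.coldStartUniversality_assembly (prover) · by planner
sources: arXiv:2204.12737
[assembly] UniformColdStartMixing → ColdStartContinuumCauchy → ColdStartSolutionsExist → YM3TorusSU2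
(the deciding theorem `closes` proves exactly this implication, sorry-free) -/
@[route_item "route-QuantumFields-ColdStartUniversality"]
def Assembly : Prop :=
  Summit.QuantumFields.YangMills.Theses.ColdStartUniversality.UniformColdStartMixing → Summit.QuantumFields.YangMills.Theses.ColdStartUniversality.ColdStartContinuumCauchy → Summit.QuantumFields.YangMills.Theses.ColdStartUniversality.ColdStartSolutionsExist → Literature.MathematicalPhysics.QuantumFieldTheory.Balaban1983to89.T3YM3TorusStatement.YM3TorusSU2

-- `Assembly` holds: proved by `Summit.QuantumFields.YangMills.Theorems.coldStartUniversality_assembly` (its module imports this route file, so no `_holds` link can be stated here).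

/-! D-0027 §2.1 — DECIDING THEOREM (planner-authored via `route open/edit --closes-file`; by planner-ym-idea-5-g7-0 2026-08-28T10:11:52Z):
its hypotheses are this route's items and its conclusion the registered leaf `Literature.MathematicalPhysics.QuantumFieldTheory.Balaban1983to89.T3YM3TorusStatement.YM3TorusSU2` (rung R3, D-0061) (glue_lint), and it elaborates with this file. -/

/-- DECIDING THEOREM (rev 3, LINE «centre-sector reduction»): the Z₂³ electric centre symmetry of the finite-volume Wilson
theory is EXACT at every cut-off (`T3ContinuumYM3Torus.expectAt_eq_zero_of_odd_SU2`: a loop string whose windings add up to an odd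
number in some direction has expectation 0 at every K), so the CHARGED sector of the leaf is decided with no dynamics at all, and the
cold-start mixing hypothesis is needed — and asked — only on the centre-NEUTRAL sector (`NeutralColdStartMixing`). -/
@[closes "route-QuantumFields-ColdStartUniversality"] theorem closes (hN1 : NeutralColdStartMixing) (hA2 : ColdStartContinuumCauchy) (hEx : ColdStartSolutionsExist) :
    Literature.MathematicalPhysics.QuantumFieldTheory.Balaban1983to89.T3YM3TorusStatement.YM3TorusSU2 := by
  obtain ⟨γ₁, hγ₁, h1⟩ := hN1
  refine ⟨γ₁, hγ₁, fun F γ hγ hγle => ?_⟩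
  rw [Literature.MathematicalPhysics.QuantumFieldTheory.Balaban1983to89.T3ContinuumYM3Torus.continuumYM3Torus_iff_hasContinuumLimit_SU
    F _ Literature.MathematicalPhysics.QuantumFieldTheory.Balaban1983to89.T4ApexTwoLevel.measurableE_expMeanLogSU hγ.le]
  intro os
  set e : ℕ → ℝ := fun K =>
    (F.scheme (Literature.MathematicalPhysics.QuantumFieldTheory.Balaban1983to89.ExpMeanLog.expMeanLogSU :
      Literature.MathematicalPhysics.QuantumFieldTheory.Balaban1983to89.LoopAverage (Matrix.specialUnitaryGroup (Fin 2) ℂ)) γ).expectAt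
      K os with he
  -- CHARGED SECTOR: exact vanishing at every cut-off (centre symmetry), hence a constant sequence.
  by_cases hodd : ∃ μ : Fin 3,
      Odd (os.map (Literature.MathematicalPhysics.QuantumFieldTheory.Balaban1983to89.T3ContinuumYM3Torus.ULoop3.wind μ)).sum
  · obtain ⟨μ, hμ⟩ := hodd
    have h0 : e = fun _ => 0 := funext fun K =>
      Literature.MathematicalPhysics.QuantumFieldTheory.Balaban1983to89.T3ContinuumYM3Torus.expectAt_eq_zero_of_odd_SU2 F _ γ K hμ
    exact ⟨0, by rw [h0]; exact tendsto_const_nhds⟩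
  -- NEUTRAL SECTOR: the cold-start argument of rev 2, with the mixing hypothesis restricted to neutral strings.
  have hev : ∀ μ : Fin 3,
      Even (os.map (Literature.MathematicalPhysics.QuantumFieldTheory.Balaban1983to89.T3ContinuumYM3Torus.ULoop3.wind μ)).sum :=
    fun μ => Int.not_odd_iff_even.mp fun h => hodd ⟨μ, h⟩
  have hcs : CauchySeq e := by
    refine Metric.cauchySeq_iff.mpr fun ε hε => ?_
    obtain ⟨T, hT, K₀, hK₀⟩ := h1 F γ hγ hγle os hev (ε / 4) (by positivity)
    choose Ω mΩ P hP W hW U hU0 hUsol using fun K => hEx F γ K hγ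
    set a : ℕ → ℝ := fun K => T⁻¹ * intervalIntegral (fun s : ℝ => MeasureTheory.integral (P K) fun ω =>
      (os.map fun C => F.avgObs
        (Literature.MathematicalPhysics.QuantumFieldTheory.Balaban1983to89.ExpMeanLog.expMeanLogSU :
          Literature.MathematicalPhysics.QuantumFieldTheory.Balaban1983to89.LoopAverage (Matrix.specialUnitaryGroup (Fin 2) ℂ)) K C
        (fun b : Literature.MathematicalPhysics.QuantumFieldTheory.Balaban1983to89.PBond (F.P K) 0 =>
          U K (s / (F.P K).eps).toNNReal ω (b.src, b.dir))).prod) 0 T MeasureTheory.volume with ha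
    have hac : CauchySeq a := hA2 F γ hγ os T hT a fun K =>
      ⟨Ω K, mΩ K, P K, hP K, W K, hW K, U K, hU0 K, hUsol K, rfl⟩
    obtain ⟨N₁, hN₁⟩ := Metric.cauchySeq_iff.mp hac (ε / 4) (by positivity)
    refine ⟨max K₀ N₁, fun m hm n hn => ?_⟩
    have hm₁ : |e m - a m| ≤ ε / 4 :=
      hK₀ m (le_of_max_le_left hm) (Ω m) (mΩ m) (P m) (hP m) (W m) (hW m) (U m) (hU0 m) (hUsol m)
    have hn₁ : |e n - a n| ≤ ε / 4 :=
      hK₀ n (le_of_max_le_left hn) (Ω n) (mΩ n) (P n) (hP n) (W n) (hW n) (U n) (hU0 n) (hUsol n)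
    have hmn : dist (a m) (a n) < ε / 4 := hN₁ m (le_of_max_le_right hm) n (le_of_max_le_right hn)
    rw [Real.dist_eq] at hmn ⊢
    calc |e m - e n| = |(e m - a m) + (a m - a n) - (e n - a n)| := by ring_nf
      _ ≤ |(e m - a m) + (a m - a n)| + |e n - a n| := abs_sub _ _
      _ ≤ |e m - a m| + |a m - a n| + |e n - a n| := by gcongr; exact abs_add_le _ _
      _ < ε := by linarith
  exact cauchySeq_tendsto_of_complete hcs

end Summit.QuantumFields.YangMills.Theses.ColdStartUniversality
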